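import Literature.MathematicalPhysics.QuantumFieldTheory.Balaban1983to89.B1Eq324BenfattoLemma
import HarnessLib

/-!
# `Balaban1983to89.B1Eq324BenfattoSect5AnchoredColourings` — [BenfattoEtAl1978] §5 p. 159 «Collecting all the errors»: the
# ANCHORED COLOURING SUM — summing a product weight over the colourings of `n` slots by a finite palette that USE a given colour costs
# `n · w(c₀) · (Σ_c w(c))^{n−1}` — the last counting step of the cross-cluster bound — PROVED

statement-level skeleton of published theorems with citation tags; proofs where landed; nothing here is a claim about the
Yang–Mills mass gap

WHY THIS MODULE (cell `pub-ymgap`, seat `dag-n08-c`, node N08; layer 3 of the assembly).  After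
`B1Eq324BenfattoSect5FreeCumulants.abs_sum_cross_le_sum_anchored` (n08-b) the cross terms of a pavement step are a sum over the boxes `m`
of a sum over the colourings USING the colour `A_m = Ψ″₁(□_m)`; `B1Eq324BenfattoSect5TupleClustersDecay.abs_ursellOf_tupleSums_condField_le_prod_decayMass`
bounds each such colouring by `C·Π_j DM^{(m)}_{f(j)}` with DECAY-WEIGHTED masses `DM^{(m)}_c` (each `O(A)` uniformly in the volume by
`…SlotMasses` / `…CrossCount`).  The remaining sum over the colourings using `A_m` of the product weight is the elementary bound of
this file: `≤ n·DM(A_m)·(Σ_c DM_c)^{n−1}` — so the cross terms cost `|B|·O(1)`, i.e. `|I|·S(…)` as in (4.6)/(4.7).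

WHAT IS PROVED (theorems only; no definition, no named fact, no `sorry`; axioms standard).
* `sum_filter_apply_eq_prod_eq` — colourings with slot `j` painted `c₀`: `Σ_{f : f j = c₀} Π_i w(f i) = w(c₀)·(Σ_c w c)^{n−1}`.
* ★ `sum_filter_exists_apply_eq_prod_le` — colourings USING `c₀` (non-negative weights):
  `Σ_{f : ∃ j, f j = c₀} Π_i w(f i) ≤ n·w(c₀)·(Σ_c w c)^{n−1}` (union bound over the slot carrying `c₀`).

HONEST SCOPE / NOT HERE.  Finite combinatorics only; the pairing with the two files above is the assembly's (`…Sect5FreeStep`, n08-b);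
`BasicLemmaPrinted` stays OPEN.  NOT summit progress; count-neutral for N08; nothing of [Balaban1985UV3] is asserted.
-/

open Finset
open scoped BigOperators

namespace Literature.MathematicalPhysics.QuantumFieldTheory.Balaban1983to89.B1Eq324BenfattoSect5AnchoredColourings

variable {P : Type*} [Fintype P] [DecidableEq P]

/-- Sum over a union is at most the sum of the sums (non-negative summand). [folklore] -/
private theorem sum_biUnion_le_sum_sum {ι β : Type*} [DecidableEq β] (s : Finset ι) (t : ι → Finset β) (g : β → ℝ)
    (hg : ∀ x, 0 ≤ g x) : ∑ x ∈ s.biUnion t, g x ≤ ∑ i ∈ s, ∑ x ∈ t i, g x := by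
  classical
  induction s using Finset.induction_on with
  | empty => simp
  | insert a s ha ih =>
    rw [Finset.biUnion_insert, Finset.sum_insert ha]
    have h := Finset.sum_union_inter (s₁ := t a) (s₂ := s.biUnion t) (f := g)
    have hint : 0 ≤ ∑ x ∈ t a ∩ s.biUnion t, g x := Finset.sum_nonneg fun x _ => hg x
    linarith

/-- **Colourings with slot `j` painted `c₀`**: `Σ_{f : Fin n → P, f j = c₀} Π_i w(f i) = w(c₀)·(Σ_c w c)^{n−1}` (the other `n − 1` slots are
free). [cite: BenfattoEtAl1978, §5 p.159] -/
theorem sum_filter_apply_eq_prod_eq {n : ℕ} (w : P → ℝ) (c₀ : P) (j : Fin n) :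
    ∑ f ∈ (Finset.univ : Finset (Fin n → P)).filter (fun f => f j = c₀), ∏ i, w (f i) =
      w c₀ * (∑ c, w c) ^ (n - 1) := by
  classical
  set t : Fin n → Finset P := Function.update (fun _ => (Finset.univ : Finset P)) j {c₀} with ht
  have hfilter : (Finset.univ : Finset (Fin n → P)).filter (fun f => f j = c₀) = Fintype.piFinset t := by
    ext f
    simp only [Finset.mem_filter, Finset.mem_univ, true_and, Fintype.mem_piFinset, ht]
    constructor
    · intro hf i
      by_cases hij : i = j
      · subst hij; rw [Function.update_self, Finset.mem_singleton]; exact hf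
      · rw [Function.update_of_ne hij]; exact Finset.mem_univ _
    · intro hf
      have := hf j
      rwa [Function.update_self, Finset.mem_singleton] at this
  rw [hfilter, ← Finset.prod_univ_sum t (fun _ c => w c), ← Finset.mul_prod_erase Finset.univ _ (Finset.mem_univ j)]
  congr 1
  · rw [ht, Function.update_self, Finset.sum_singleton]
  · rw [Finset.prod_congr rfl (fun i hi => by
        rw [ht, Function.update_of_ne (Finset.ne_of_mem_erase hi)]), Finset.prod_const, Finset.card_erase_of_mem (Finset.mem_univ j),
      Finset.card_univ, Fintype.card_fin]

/-- **THE ANCHORED COLOURING SUM**: for non-negative weights, the colourings of `n` slots that USE the colour `c₀` carry total product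
weight `≤ n·w(c₀)·(Σ_c w c)^{n−1}` — union bound over the slot carrying `c₀`, then `sum_filter_apply_eq_prod_eq`.
[cite: BenfattoEtAl1978, §5 p.159] -/
theorem sum_filter_exists_apply_eq_prod_le {n : ℕ} (w : P → ℝ) (hw : ∀ c, 0 ≤ w c) (c₀ : P) :
    ∑ f ∈ (Finset.univ : Finset (Fin n → P)).filter (fun f => ∃ j, f j = c₀), ∏ i, w (f i) ≤
      n * (w c₀ * (∑ c, w c) ^ (n - 1)) := by
  classical
  have hsub : (Finset.univ : Finset (Fin n → P)).filter (fun f => ∃ j, f j = c₀) ⊆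
      (Finset.univ : Finset (Fin n)).biUnion fun j => (Finset.univ : Finset (Fin n → P)).filter (fun f => f j = c₀) := by
    intro f hf
    obtain ⟨j, hj⟩ := (Finset.mem_filter.1 hf).2
    exact Finset.mem_biUnion.2 ⟨j, Finset.mem_univ _, Finset.mem_filter.2 ⟨Finset.mem_univ _, hj⟩⟩
  have hnn : ∀ f : Fin n → P, 0 ≤ ∏ i, w (f i) := fun f => Finset.prod_nonneg fun i _ => hw (f i)
  calc ∑ f ∈ (Finset.univ : Finset (Fin n → P)).filter (fun f => ∃ j, f j = c₀), ∏ i, w (f i)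
      ≤ ∑ f ∈ (Finset.univ : Finset (Fin n)).biUnion
          (fun j => (Finset.univ : Finset (Fin n → P)).filter (fun f => f j = c₀)), ∏ i, w (f i) :=
        Finset.sum_le_sum_of_subset_of_nonneg hsub fun f _ _ => hnn f
    _ ≤ ∑ j : Fin n, ∑ f ∈ (Finset.univ : Finset (Fin n → P)).filter (fun f => f j = c₀), ∏ i, w (f i) :=
        sum_biUnion_le_sum_sum _ _ _ hnn
    _ = ∑ _j : Fin n, w c₀ * (∑ c, w c) ^ (n - 1) := Finset.sum_congr rfl fun j _ => sum_filter_apply_eq_prod_eq w c₀ j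
    _ = n * (w c₀ * (∑ c, w c) ^ (n - 1)) := by rw [Finset.sum_const, Finset.card_univ, Fintype.card_fin, nsmul_eq_mul]

end Literature.MathematicalPhysics.QuantumFieldTheory.Balaban1983to89.B1Eq324BenfattoSect5AnchoredColourings
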